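import Literature.NumberTheory.EllipticCurves.IwasawaEulerCharDualityProofs
import HarnessLib

/-!
# Pontryagin duality at the LAYERS of a `ℤ_p`-tower: `X ⧸ ω_n X ≅ Hom(S^{γ^{pⁿ} = 1}, ℚ/ℤ)` for a dual
# pair, `ω_n = (1 + T)^{pⁿ} − 1`

Sibling proof file (theorems only: no definition, no named fact, no `sorry`) of
`IwasawaEulerCharDualityProofs` / `SelmerCorankControlCoinvariantsProofs`, in the tree's untopologised
axiomatic setting `IwasawaDual.IsDualPair p ψ toDual` (`toDual : X ≃ Hom(S, ℚ/ℤ)` for a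
`Λ = ℤ_p⟦T⟧`-module `X` and an abelian group `S`, `T` acting as the endomorphism `ψ` of `S`). Those files
prove the BASE-LAYER dualities `X/TX ≅ Hom(S^{ψ = 0}, ℚ/ℤ)` (`IsDualPair.exists_coinvariants_addEquiv`)
and `X[T] ≅ Hom(S/ψS, ℚ/ℤ)`. For the control theorem ALONG THE LAYERS `K_n` of a `ℤ_p`-extension
(Greenberg, LNM 1716, §3, the maps `s_n : Sel(K_n) → Sel(K_∞)^{Γ_n}`, `Γ_n = ⟨γ^{pⁿ}⟩`) one needs the
layer-`n` analogue: with `ψ = φ − 1` (`φ = conj_γ`),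

  `ω_n = (1 + T)^{pⁿ} − 1 ∈ Λ` acts on `X` as `φ^{pⁿ} − 1` on `S`, and
  `X ⧸ ω_n X ≅ Hom(ker (φ^{pⁿ} − 1), ℚ/ℤ) = Hom(S^{Γ_n}, ℚ/ℤ)`

(Greenberg, LNM 1716, §1 p. 62: "`Λ/θ_n Λ`", `θ_n = (1+T)^{pⁿ} − 1`; §3 p. 85; Washington §13.4). Proved here,
for an ARBITRARY pair `(f, g)` with `f ∈ Λ` acting on `X` as precomposition by an endomorphism `g` of `S`:

* `IsDualPair.toDual_one_add_X_pow_smul` — `(1+T)^k` acts as `φ^k`; `IsDualPair.toDual_omega_smul` —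
  `ω_n` acts as `φ^{pⁿ} − 1`;
* `IsDualPair.exists_eq_smul_of_forall_ker` — exactness of Pontryagin duality at `X ⧸ fX`: a character
  `toDual x` killing `ker g` is `toDual (f • y)` (it factors through `S/ker g ≅ g(S)` and extends from `g(S)`
  to `S`, `ℚ/ℤ` being injective — Mathlib `CharacterModule.dual_surjective_of_injective`);
* **`IsDualPair.exists_quotient_addEquiv_of_smul`** — `X ⧸ (f)X ≃ Hom(ker g, ℚ/ℤ)` by restriction of
  characters, with its defining formula; **`IsDualPair.exists_layerCoinvariants_addEquiv`** — the case
  `f = ω_n`, `g = φ^{pⁿ} − 1`: `X ⧸ ω_n X ≅ Hom(S^{φ^{pⁿ} = 1}, ℚ/ℤ)`;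
* counting: `IsDualPair.natCard_layerCoinvariants`, `…finite_layerCoinvariants_iff` —
  `#(X ⧸ ω_n X) = #S^{φ^{pⁿ} = 1}` (`Nat.card`), finiteness transfers.

The quotient is written `X ⧸ (Ideal.span {ω_n} • ⊤)`, the currency of the tree's layer-tower files. Nothing
about Selmer groups is asserted here; the elliptic-curve instances (`X_ac^Σ(E[p^∞])`, `X(E/K_∞)`) are the
callers' business.

## References

* [GreenbergLNM1716] R. Greenberg, *Iwasawa theory for elliptic curves*, LNM 1716 (1999), §1 pp. 60–62
  (`X/TX` dual to `Sel^Γ`; `Λ/θ_n Λ`, `θ_n = (1+T)^{pⁿ} − 1`), §3 p. 85 (`Sel_E(F_∞)^{Γ_n}`).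
* [Washington1997] L. Washington, *Introduction to Cyclotomic Fields*, 2nd ed., §13.2 (`ω_n`), §13.4.

## Design

No definitions; `noncomputable section`; the quotient by `f • X` is `X ⧸ (Ideal.span {f} • ⊤ : Submodule Λ X)`
so that it matches `Module.fittingIdeal`-side statements (`…LayerTowerControl`). Axioms: `propext`,
`Classical.choice`, `Quot.sound`.
-/

noncomputable section

open scoped Classical

namespace Literature.NumberTheory.EllipticCurves

namespace IwasawaDual

open PontryaginCard

variable {p : ℕ} [Fact p.Prime]
variable {S : Type*} [AddCommGroup S] {ψ φ : AddMonoid.End S}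
variable {X : Type*} [AddCommGroup X] [Module (PowerSeries ℤ_[p]) X]
variable {toDual : X →+ (S →+ AddCircle (1 : ℚ))}

/-! ## `(1 + T)^k` acts as `φ^k`, `ω_n = (1+T)^{pⁿ} − 1` as `φ^{pⁿ} − 1` -/

/-- For a dual pair with `T ↔ φ − 1`: **`1 + T` acts as `φ`**, `toDual ((1+T) • x) s = toDual x (φ s)`.
[cite: GreenbergLNM1716, §1 p. 60 (`T = γ − 1`)] -/
theorem IsDualPair.toDual_one_add_X_smul (h : IsDualPair p (φ - 1) toDual) (x : X) (s : S) :
    toDual ((1 + PowerSeries.X : PowerSeries ℤ_[p]) • x) s = toDual x (φ s) := by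
  rw [add_smul, one_smul, map_add, AddMonoidHom.add_apply, h.T_smul, End_sub_apply,
    AddMonoid.End.one_apply, map_sub, add_sub_cancel]

/-- For a dual pair with `T ↔ φ − 1`: **`(1 + T)^k` acts as `φ^k`**,
`toDual ((1+T)^k • x) s = toDual x (φ^k s)`. [cite: GreenbergLNM1716, §1 p. 62 (`θ_n = (1+T)^{pⁿ} − 1`)] -/
theorem IsDualPair.toDual_one_add_X_pow_smul (h : IsDualPair p (φ - 1) toDual) (k : ℕ) (x : X) (s : S) :
    toDual (((1 + PowerSeries.X : PowerSeries ℤ_[p]) ^ k) • x) s = toDual x ((φ ^ k) s) := by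
  induction k generalizing x with
  | zero => rw [pow_zero, one_smul, pow_zero, AddMonoid.End.one_apply]
  | succ k ih =>
    rw [pow_succ, mul_smul, ih, h.toDual_one_add_X_smul, pow_succ', AddMonoid.End.coe_mul,
      Function.comp_apply]

/-- For a dual pair with `T ↔ φ − 1`: **the layer polynomial `ω_n = (1 + T)^{pⁿ} − 1` acts as
`φ^{pⁿ} − 1`**, `toDual (ω_n • x) s = toDual x ((φ^{pⁿ} − 1) s)` — for `φ = conj_γ` this is
`x(conj_{γ^{pⁿ}} s) − x(s)`, so `ω_n X` is dual to the `γ^{pⁿ}`-COINVARIANTS and `X ⧸ ω_n X` to the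
`γ^{pⁿ}`-INVARIANTS of `S`. [cite: GreenbergLNM1716, §1 p. 62 (`θ_n = (1+T)^{pⁿ} − 1`)] [cite: Washington1997, §13.2] -/
theorem IsDualPair.toDual_omega_smul (h : IsDualPair p (φ - 1) toDual) (n : ℕ) (x : X) (s : S) :
    toDual (((1 + PowerSeries.X : PowerSeries ℤ_[p]) ^ (p ^ n) - 1) • x) s =
      toDual x ((φ ^ (p ^ n) - 1) s) := by
  rw [sub_smul, one_smul, map_sub, AddMonoidHom.sub_apply, h.toDual_one_add_X_pow_smul, End_sub_apply,
    AddMonoid.End.one_apply, map_sub]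

/-! ## Exactness of Pontryagin duality at `X ⧸ fX` when `f` acts as precomposition by `g` -/

/-- **Exactness of Pontryagin duality at `X ⧸ fX`.** For a dual pair (`toDual : X ≃ Hom(S, ℚ/ℤ)`) and a
pair `(f, g)` with `f ∈ Λ` acting on `X` as precomposition by the endomorphism `g` of `S`
(`toDual (f • x) = toDual x ∘ g`): an element `x ∈ X` whose character kills `ker g` lies in `f • X` —
the character factors through `S / ker g ≅ g(S)` and the induced character of `g(S)` extends to `S`
(injectivity of `ℚ/ℤ`, Mathlib `CharacterModule.dual_surjective_of_injective`), `toDual x = y ∘ g =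
toDual (f • x')`. The case `f = T`, `g = ψ` is the tree's `IsDualPair.exists_eq_X_smul_of_forall_ker`.
[cite: GreenbergLNM1716, §1 pp. 60, 65 (`X/TX` dual to `Sel^Γ`)] -/
theorem IsDualPair.exists_eq_smul_of_forall_ker (h : IsDualPair p ψ toDual) {f : PowerSeries ℤ_[p]}
    {g : AddMonoid.End S} (hfg : ∀ (x : X) (s : S), toDual (f • x) s = toDual x (g s)) {x : X}
    (hx : ∀ s : S, g s = 0 → toDual x s = 0) : ∃ y : X, x = f • y := by
  let δ : S →+ S := g
  have hker : δ.rangeRestrict.ker ≤ (toDual x).ker := by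
    intro s hs
    rw [AddMonoidHom.mem_ker] at hs ⊢
    exact hx s (congrArg (fun z : δ.range ↦ (z : S)) hs)
  have hsurj : Function.Surjective δ.rangeRestrict := AddMonoidHom.rangeRestrict_surjective δ
  let χ' : δ.range →+ AddCircle (1 : ℚ) :=
    δ.rangeRestrict.liftOfSurjective hsurj ⟨toDual x, hker⟩
  have hχ' : ∀ s, χ' (δ.rangeRestrict s) = toDual x s := fun s ↦
    AddMonoidHom.liftOfRightInverse_comp_apply _ _ _ _ s
  obtain ⟨y, hy⟩ := CharacterModule.dual_surjective_of_injective
    (δ.range.subtype.toIntLinearMap) (fun a b hab ↦ Subtype.ext hab) χ'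
  have hy' : ∀ r : δ.range, y r = χ' r := fun r ↦ by
    have := DFunLike.congr_fun hy r
    rw [CharacterModule.dual_apply] at this
    exact this
  let y₀ : S →+ AddCircle (1 : ℚ) := y
  have hsplit : ∀ s, toDual x s = y₀ (g s) := by
    intro s
    rw [← hχ' s, ← hy']
    rfl
  obtain ⟨x₂, hx₂⟩ := h.bijective.2 y₀
  refine ⟨x₂, h.bijective.1 ?_⟩
  ext s
  rw [hfg, hx₂, hsplit]

/-- Elements of `(f) • X = Ideal.span {f} • ⊤` are the `f • y` (private plumbing). [folklore] -/
private theorem mem_span_singleton_smul_top_iff (f : PowerSeries ℤ_[p]) (x : X) :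
    x ∈ (Ideal.span {f} • ⊤ : Submodule (PowerSeries ℤ_[p]) X) ↔ ∃ y : X, x = f • y := by
  rw [Submodule.ideal_span_singleton_smul, Submodule.mem_smul_pointwise_iff_exists]
  exact ⟨fun ⟨y, _, hy⟩ ↦ ⟨y, hy.symm⟩, fun ⟨y, hy⟩ ↦ ⟨y, Submodule.mem_top, hy.symm⟩⟩

/-- **`X ⧸ fX ≅ Hom(ker g, ℚ/ℤ)` when `f` acts as precomposition by `g`.** For a dual pair and a pair
`(f, g)` with `toDual (f • x) = toDual x ∘ g`: restriction of characters to `ker g = endInvariants g`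
induces an additive isomorphism `X ⧸ (f)X ≃ Hom(ker g, ℚ/ℤ)` — it kills `fX` (`toDual (f • y)` vanishes on
`ker g`), is injective modulo `fX` (`exists_eq_smul_of_forall_ker`) and onto (characters of `ker g ⊆ S`
extend). This is Pontryagin duality applied to `0 → ker g → S →(g) S`. The case `f = T`, `g = ψ` is the
tree's `IsDualPair.exists_coinvariants_addEquiv`. [cite: GreenbergLNM1716, §1 pp. 60, 65] -/
theorem IsDualPair.exists_quotient_addEquiv_of_smul (h : IsDualPair p ψ toDual) {f : PowerSeries ℤ_[p]}
    {g : AddMonoid.End S} (hfg : ∀ (x : X) (s : S), toDual (f • x) s = toDual x (g s)) :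
    ∃ Ψ : (X ⧸ (Ideal.span {f} • ⊤ : Submodule (PowerSeries ℤ_[p]) X)) ≃+ CharacterModule ↥(endInvariants g),
      ∀ (x : X) (a : endInvariants g), Ψ (Submodule.Quotient.mk x) a = toDual x a := by
  let R₀ : X →+ CharacterModule ↥(endInvariants g) :=
    { toFun := fun x ↦ (toDual x).comp (endInvariants g).subtype
      map_zero' := by rw [map_zero, AddMonoidHom.zero_comp]; rfl
      map_add' := fun x y ↦ by rw [map_add, AddMonoidHom.add_comp]; rfl }
  have hR₀ : ∀ (x : X) (a : endInvariants g), R₀ x a = toDual x a := fun _ _ ↦ rfl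
  have hR₀f : ∀ y : X, R₀ (f • y) = 0 := fun y ↦ by
    refine CharacterModule.ext (A := ↥(endInvariants g)) fun a ↦ ?_
    rw [hR₀, hfg, characterModule_zero_apply, (mem_endInvariants_iff g _).mp a.2, map_zero]
  let N : Submodule (PowerSeries ℤ_[p]) X := Ideal.span {f} • ⊤
  let R : (X ⧸ N) →+ CharacterModule ↥(endInvariants g) :=
    QuotientAddGroup.lift N.toAddSubgroup R₀ (by
      intro m hm
      rw [Submodule.mem_toAddSubgroup, mem_span_singleton_smul_top_iff] at hm
      obtain ⟨y, rfl⟩ := hm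
      exact hR₀f y)
  have hRmk : ∀ x : X, R (Submodule.Quotient.mk x) = R₀ x := fun _ ↦ rfl
  have hRbij : Function.Bijective R := by
    constructor
    · rw [injective_iff_map_eq_zero]
      intro q hq
      induction q using Submodule.Quotient.induction_on with
      | H x =>
        rw [hRmk] at hq
        have hx : ∀ s : S, g s = 0 → toDual x s = 0 := fun s hs ↦ by
          have := DFunLike.congr_fun hq ⟨s, (mem_endInvariants_iff g s).mpr hs⟩
          rwa [hR₀] at this
        obtain ⟨y, rfl⟩ := h.exists_eq_smul_of_forall_ker hfg hx
        exact (Submodule.Quotient.mk_eq_zero N).mpr ((mem_span_singleton_smul_top_iff f _).mpr ⟨y, rfl⟩)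
    · intro χ
      obtain ⟨χ', hχ'⟩ := CharacterModule.dual_surjective_of_injective
        (endInvariants g).subtype.toIntLinearMap (fun a b hab ↦ Subtype.ext hab) χ
      obtain ⟨x, hx⟩ := h.bijective.2 χ'
      refine ⟨Submodule.Quotient.mk x, ?_⟩
      rw [hRmk]
      refine CharacterModule.ext (A := ↥(endInvariants g)) fun a ↦ ?_
      rw [hR₀, hx, ← hχ']
      rfl
  exact ⟨AddEquiv.ofBijective R hRbij, fun x a ↦ rfl⟩

/-- **Counting form**: `#(X ⧸ fX) = #ker g` (`Nat.card`; both `0` when infinite), when `f` acts as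
precomposition by `g`. [cite: GreenbergLNM1716, §1 p. 60] -/
theorem IsDualPair.natCard_quotient_eq_of_smul (h : IsDualPair p ψ toDual) {f : PowerSeries ℤ_[p]}
    {g : AddMonoid.End S} (hfg : ∀ (x : X) (s : S), toDual (f • x) s = toDual x (g s)) :
    Nat.card (X ⧸ (Ideal.span {f} • ⊤ : Submodule (PowerSeries ℤ_[p]) X)) = Nat.card ↥(endInvariants g) := by
  obtain ⟨Ψ, -⟩ := h.exists_quotient_addEquiv_of_smul hfg
  exact natCard_eq_of_addEquiv_characterModule Ψ

/-- `X ⧸ fX` is finite iff `ker g` is, when `f` acts as precomposition by `g`.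
[cite: GreenbergLNM1716, §1 p. 60] -/
theorem IsDualPair.finite_quotient_iff_of_smul (h : IsDualPair p ψ toDual) {f : PowerSeries ℤ_[p]}
    {g : AddMonoid.End S} (hfg : ∀ (x : X) (s : S), toDual (f • x) s = toDual x (g s)) :
    Finite (X ⧸ (Ideal.span {f} • ⊤ : Submodule (PowerSeries ℤ_[p]) X)) ↔ Finite ↥(endInvariants g) := by
  obtain ⟨Ψ, -⟩ := h.exists_quotient_addEquiv_of_smul hfg
  exact finite_iff_of_addEquiv_characterModule Ψ

/-! ## The layers: `X ⧸ ω_n X ≅ Hom(S^{φ^{pⁿ} = 1}, ℚ/ℤ)` -/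

/-- **Pontryagin duality at layer `n`: `X ⧸ ω_n X ≅ Hom(S^{φ^{pⁿ} = 1}, ℚ/ℤ)`**, `ω_n = (1 + T)^{pⁿ} − 1`, for
a dual pair with `T ↔ φ − 1` — restriction of characters to `ker (φ^{pⁿ} − 1)`, the subgroup of `S` fixed
by `φ^{pⁿ}` (for `S = Sel(K_∞)`, `φ = conj_γ`: the invariants `Sel(K_∞)^{Γ_n}` under `Γ_n = ⟨γ^{pⁿ}⟩`,
the target of the layer-`n` control map `s_n`). The case `n = 0` (`ω_0 = T`) is `exists_coinvariants_addEquiv`.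
[cite: GreenbergLNM1716, §1 p. 62 and §3 p. 85 (`Sel_E(F_∞)^{Γ_n}`, `θ_n`)] [cite: Washington1997, §13.4] -/
theorem IsDualPair.exists_layerCoinvariants_addEquiv (h : IsDualPair p (φ - 1) toDual) (n : ℕ) :
    ∃ Ψ : (X ⧸ (Ideal.span {((1 + PowerSeries.X : PowerSeries ℤ_[p]) ^ (p ^ n) - 1)} • ⊤ :
        Submodule (PowerSeries ℤ_[p]) X)) ≃+ CharacterModule ↥(endInvariants (φ ^ (p ^ n) - 1)),
      ∀ (x : X) (a : endInvariants (φ ^ (p ^ n) - 1)), Ψ (Submodule.Quotient.mk x) a = toDual x a :=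
  h.exists_quotient_addEquiv_of_smul (h.toDual_omega_smul n)

/-- **`#(X ⧸ ω_n X) = #S^{φ^{pⁿ} = 1}`** (`Nat.card`; both `0` when infinite): the number of
`γ^{pⁿ}`-invariant classes equals the order of the layer-`n` coinvariants of the dual.
[cite: GreenbergLNM1716, §1 p. 62 and §3 p. 85] -/
theorem IsDualPair.natCard_layerCoinvariants (h : IsDualPair p (φ - 1) toDual) (n : ℕ) :
    Nat.card (X ⧸ (Ideal.span {((1 + PowerSeries.X : PowerSeries ℤ_[p]) ^ (p ^ n) - 1)} • ⊤ :
        Submodule (PowerSeries ℤ_[p]) X)) = Nat.card ↥(endInvariants (φ ^ (p ^ n) - 1)) :=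
  h.natCard_quotient_eq_of_smul (h.toDual_omega_smul n)

/-- `X ⧸ ω_n X` is finite iff `S^{φ^{pⁿ} = 1}` is. [cite: GreenbergLNM1716, §1 p. 62 and §3 p. 85] -/
theorem IsDualPair.finite_layerCoinvariants_iff (h : IsDualPair p (φ - 1) toDual) (n : ℕ) :
    Finite (X ⧸ (Ideal.span {((1 + PowerSeries.X : PowerSeries ℤ_[p]) ^ (p ^ n) - 1)} • ⊤ :
        Submodule (PowerSeries ℤ_[p]) X)) ↔ Finite ↥(endInvariants (φ ^ (p ^ n) - 1)) :=
  h.finite_quotient_iff_of_smul (h.toDual_omega_smul n)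

/-- **Monotonicity along the tower on the dual side**: `ω_n ∣ ω_{n'}` for `n ≤ n'`
(`ω_{n'} = ((1+T)^{pⁿ})^{p^{n'−n}} − 1` and `a − 1 ∣ a^k − 1`), hence `ω_{n'} X ⊆ ω_n X` and
`X ⧸ ω_{n'} X ↠ X ⧸ ω_n X` — dual to the inclusions `S^{Γ_n} ⊆ S^{Γ_{n'}}`. [cite: Washington1997, §13.2] -/
theorem omega_dvd_omega {n n' : ℕ} (hn : n ≤ n') :
    ((1 + PowerSeries.X : PowerSeries ℤ_[p]) ^ (p ^ n) - 1) ∣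
      ((1 + PowerSeries.X : PowerSeries ℤ_[p]) ^ (p ^ n') - 1) := by
  obtain ⟨k, rfl⟩ := Nat.exists_eq_add_of_le hn
  rw [pow_add, pow_mul]
  exact sub_one_dvd_pow_sub_one _ _

/-- `ω_{n'} X ⊆ ω_n X` for `n ≤ n'`. [cite: Washington1997, §13.2] -/
theorem span_omega_smul_top_antitone {n n' : ℕ} (hn : n ≤ n') :
    (Ideal.span {((1 + PowerSeries.X : PowerSeries ℤ_[p]) ^ (p ^ n') - 1)} • ⊤ :
        Submodule (PowerSeries ℤ_[p]) X) ≤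
      Ideal.span {((1 + PowerSeries.X : PowerSeries ℤ_[p]) ^ (p ^ n) - 1)} • ⊤ :=
  Submodule.smul_mono_left (Ideal.span_singleton_le_span_singleton.mpr (omega_dvd_omega hn))

end IwasawaDual

end Literature.NumberTheory.EllipticCurves

end
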